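import Mathlib.Analysis.Calculus.ContDiff.Bounds
import Mathlib.Analysis.Calculus.MeanValue
import Mathlib.Analysis.SpecialFunctions.Complex.LogDeriv
import Mathlib.RingTheory.RootsOfUnity.Complex
import Mathlib.Analysis.Complex.RealDeriv
import Mathlib.Analysis.Asymptotics.Lemmas
import Literature.Analysis.Calculus.WhitneyEvenFunctionSeveral
import Literature.Analysis.Calculus.FlatZeroSection
import HarnessLib

/-!
# Flat `C₃`-descent: a flat rotation-invariant smooth function of `w ∈ ℂ` is a smooth function of `w³` (Glaeser–`S₃` road G″, brick D)

Topic `Analysis/Calculus`.  Context: cell `pub/hodgecm-mathlib`, N8-census §5 (9) «GLAESER–CHEVALLEY FOR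
`S₃`» (the smooth Newton theorem [Glaeser1963Newton, Thm. II] for three variables), road G″ «CUBE FIRST,
THEN WHITNEY» (binder LH7-p01 (g6), LEAD F0P3a-plan T13-42 (5)); this file is brick **D** (LH5-p05 (g5)).
Count-neutral Literature THEOREMS (`--kind proof --supports stmt-HodgeConjecture-24833`); no `def`, no
instance, no notation, no `sorry`.

THE ROAD.  In the Lagrange-resolvent coordinate `w = x₀ + ωx₁ + ω²x₂` the symmetric group `S₃` acts on
`ℂ` as the dihedral group `D₃ = ⟨w ↦ ωw, w ↦ w̄⟩`, `ω = exp (2πi/3)`.  The quotient FACTORS: first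
`w ↦ w′ := w³` (quotient by the rotations `C₃`, a free action off `w = 0`), then `w′ = a′ + ib′ ↦ (a′, b′²)`
(quotient by the residual conjugation — Whitney's even-function theorem), and the dictionary back to the
basic invariants `u = |w|²`, `v = Re w³` is polynomial: `a′ = v`, `b′² = (Im w³)² = u³ − v²`.  After the
formal (Borel) part of a smooth invariant function has been subtracted at the corner `w = 0`, what is left
is FLAT there, and for flat functions the descent along `w ↦ w³` is elementary — that is this file:

* §1 cube roots: the two explicit real-smooth branches `exp (log w / 3)` (slit plane) and
  `−exp (log (−w) / 3)` (opposite slit plane), and the rotation ambiguity of cube roots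
  (`apply_eq_of_pow_three_eq_of_rotInvariant`, from Mathlib's `Complex.isPrimitiveRoot_exp`);
* §2 the descended function: `exists_comp_cube_eq_of_rotInvariant` (`f (c, z) = K (c³, z)` for all `c`),
  `contDiffOn_of_comp_cube_eq` (`K` is `C^∞` off the zero section `{0} × P`, being locally `f ∘` a branch);
* §3 **the decay estimate** `tendsto_iteratedFDeriv_of_comp_cube_eq`: if all derivatives of `f` vanish on
  `{0} × P` then every global iterated derivative of `K` tends to `0` at every section point from the
  off-section side.  On the dyadic shell `8^{-m} < ‖w′‖ ≤ 8^{1-m}` write `K = K_m ∘ M`, `M (w′, z) =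
  (8^m w′, z)` (Mathlib `ContinuousLinearEquiv.iteratedFDerivWithin_comp_right`: a factor `8^{mn}`), and on
  the FIXED annulus `1 ≤ ‖w′‖ ≤ 8` (two compact sectors, one per branch) `K_m = (f ∘ L) ∘ Ψ` with
  `L (w, z) = (2^{-m} w, z)` and `Ψ` a branch: Mathlib's chain-rule bound `norm_iteratedFDerivWithin_comp_le`
  with the branch constant `D` (compactness) and the flatness constant `C (2·2^{-m})^{3n+1}` of ★ B7 (ii)
  `isBigO_iteratedFDeriv_norm_fst_pow_of_zeroSection` gives `‖Dⁿ K‖ ≤ A · 2^{-m}`;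
* §4 **heads**: `exists_contDiff_comp_cube_of_flat_of_rotInvariant` (flat `C₃`-descent: `K` smooth on ALL of
  `ℂ × P` and flat on the section, by ★ B7 (i) `contDiff_of_iteratedFDeriv_tendsto_zero_zeroSection`), and the
  corner corollaries `exists_contDiff_comp_dihedralInvariants_of_flat` (complex form: `f (w, z) =
  F (|w|², Re w³, z)`) and `exists_contDiff_comp_dihedralInvariants_of_flat_real` (the binder's real frame
  `ℝ × ℝ × P`: `Φ (a, b, z) = G (a² + b², a³ − 3ab², z)`), through ★ `exists_contDiff_comp_sq_of_forall_even`
  (Whitney-several, one variable `Im w′`, parameter `(Re w′, z)`).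

No polar coordinates, no one-sided estimates, no Seeley bounds are needed on this road.  Values in a real
Banach space `E`, parameters in a finite-dimensional `P` (compactness of the annular sectors `× closedBall`;
Whitney-several's frame), one universe as in ★ `WhitneyEvenFunctionSeveral`.

## References

* G. Glaeser, *Fonctions composées différentiables*, Ann. of Math. 77 (1963) 193–209, Thm. II (théorème de
  Newton différentiable); author's summary Sém. Lelong 5 (1962/63) exp. 2, p. 4. [Glaeser1963Newton]
* H. Whitney, *Differentiable even functions*, Duke Math. J. 10 (1943) 159–160, Thm. 1. [Whitney1943]
* L. Hörmander, *The Analysis of Linear Partial Differential Operators I*, §1.1–1.2 (flat functions,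
  Taylor's formula). [HormanderALPDO1]
-/

noncomputable section

open Set Function Filter Metric Complex Asymptotics
open scoped Topology ContDiff Real

namespace Literature.Analysis.Calculus

universe u

/-! ### Cube roots: the two explicit branches and the rotation ambiguity -/

/-- `exp (2πi/3)` is a cube root of unity. [folklore] [cite: Glaeser1963Newton, Thm. II (summary p. 4)] -/
theorem exp_two_pi_mul_I_div_three_pow_three : Complex.exp (2 * π * I / 3) ^ 3 = 1 :=
  (Complex.isPrimitiveRoot_exp 3 (by norm_num)).pow_eq_one

/-- Two complex numbers with the same cube differ by a power of `exp (2πi/3)`. [folklore] [cite: Glaeser1963Newton, Thm. II (summary p. 4)] -/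
theorem exists_eq_exp_pow_mul_of_pow_three_eq {c d : ℂ} (h : c ^ 3 = d ^ 3) :
    ∃ j : ℕ, j < 3 ∧ c = Complex.exp (2 * π * I / 3) ^ j * d := by
  by_cases hd : d = 0
  · subst hd
    have hc : c = 0 := by
      have : c ^ 3 = 0 := by simpa using h
      exact pow_eq_zero_iff (n := 3) (by norm_num) |>.1 this
    exact ⟨0, by norm_num, by simp [hc]⟩
  · have hq : (c / d) ^ 3 = 1 := by
      rw [div_pow, h, div_self (pow_ne_zero 3 hd)]
    obtain ⟨j, hj, hje⟩ :=
      (Complex.isPrimitiveRoot_exp 3 (by norm_num)).eq_pow_of_pow_eq_one hq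
    refine ⟨j, hj, ?_⟩
    simp only [Nat.cast_ofNat] at hje
    rw [hje, div_mul_cancel₀ c hd]

/-- A function invariant under `w ↦ exp(2πi/3) • w` takes the same value at all cube roots of a
given number. [folklore] [cite: Glaeser1963Newton, Thm. II (summary p. 4)] -/
theorem apply_eq_of_pow_three_eq_of_rotInvariant {α : Type*} {P : Type*} (f : ℂ × P → α)
    (hrot : ∀ (w : ℂ) (z : P), f (Complex.exp (2 * π * I / 3) * w, z) = f (w, z))
    {c d : ℂ} (h : c ^ 3 = d ^ 3) (z : P) : f (c, z) = f (d, z) := by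
  obtain ⟨j, -, rfl⟩ := exists_eq_exp_pow_mul_of_pow_three_eq h
  clear h
  induction j with
  | zero => simp
  | succ j ih => rw [pow_succ, mul_comm (_ ^ j), mul_assoc, hrot, ih]

/-- The principal branch `exp (log w / 3)` is a cube root of `w ≠ 0`. [folklore] [cite: Glaeser1963Newton, Thm. II (summary p. 4)] -/
theorem exp_log_div_three_pow_three {w : ℂ} (hw : w ≠ 0) :
    Complex.exp (Complex.log w / 3) ^ 3 = w := by
  rw [← Complex.exp_nat_mul]
  have : (3 : ℕ) * (Complex.log w / 3) = Complex.log w := by push_cast; ring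
  rw [this, Complex.exp_log hw]

/-- The opposite branch `-exp (log (-w) / 3)` is a cube root of `w ≠ 0`. [folklore] [cite: Glaeser1963Newton, Thm. II (summary p. 4)] -/
theorem neg_exp_log_neg_div_three_pow_three {w : ℂ} (hw : w ≠ 0) :
    (-Complex.exp (Complex.log (-w) / 3)) ^ 3 = w := by
  rw [neg_pow, exp_log_div_three_pow_three (neg_ne_zero.2 hw)]
  ring

/-- The principal cube-root branch is real-smooth on the slit plane. [folklore] [cite: Glaeser1963Newton, Thm. II (summary p. 4)] -/
theorem contDiffAt_exp_log_div_three {w : ℂ} (hw : w ∈ slitPlane) {n : WithTop ℕ∞} :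
    ContDiffAt ℝ n (fun w : ℂ => Complex.exp (Complex.log w / 3)) w := by
  have h : ContDiffAt ℂ n (fun w : ℂ => Complex.exp (Complex.log w / 3)) w :=
    ((Complex.contDiffAt_log hw).div_const 3).cexp
  exact h.restrict_scalars ℝ

/-- The opposite cube-root branch is real-smooth off the closed positive real axis. [folklore] [cite: Glaeser1963Newton, Thm. II (summary p. 4)] -/
theorem contDiffAt_neg_exp_log_neg_div_three {w : ℂ} (hw : -w ∈ slitPlane) {n : WithTop ℕ∞} :
    ContDiffAt ℝ n (fun w : ℂ => -Complex.exp (Complex.log (-w) / 3)) w := by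
  have h1 : ContDiffAt ℂ n (fun w : ℂ => Complex.log (-w)) w :=
    (Complex.contDiffAt_log hw).comp w contDiffAt_id.neg
  have h2 : ContDiffAt ℂ n (fun w : ℂ => -Complex.exp (Complex.log (-w) / 3)) w :=
    (h1.div_const 3).cexp.neg
  exact h2.restrict_scalars ℝ

/-- Away from `0` one of the two branch domains applies. [folklore] [cite: Glaeser1963Newton, Thm. II (summary p. 4)] -/
theorem mem_slitPlane_or_neg_mem_slitPlane {w : ℂ} (hw : w ≠ 0) :
    w ∈ slitPlane ∨ -w ∈ slitPlane := by
  rw [mem_slitPlane_iff, mem_slitPlane_iff]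
  by_cases him : w.im = 0
  · have hre : w.re ≠ 0 := by
      intro hre; exact hw (Complex.ext hre him)
    rcases lt_or_gt_of_ne hre with h | h
    · exact Or.inr (Or.inl (by simp; linarith))
    · exact Or.inl (Or.inl h)
  · exact Or.inl (Or.inr him)

/-- The closed sector `{w | -‖w‖/2 ≤ re w}` minus the origin lies in the slit plane. [folklore] [cite: Glaeser1963Newton, Thm. II (summary p. 4)] -/
theorem mem_slitPlane_of_neg_norm_div_two_le_re {w : ℂ} (hw : w ≠ 0) (h : -‖w‖ / 2 ≤ w.re) :
    w ∈ slitPlane := by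
  rw [mem_slitPlane_iff]
  by_cases him : w.im = 0
  · left
    have habs : |w.re| = ‖w‖ := Complex.abs_re_eq_norm.2 him
    have hpos : 0 < ‖w‖ := norm_pos_iff.2 hw
    rcases abs_eq_abs.1 (habs.trans (abs_of_pos hpos).symm) with h' | h'
    · rw [h']; exact hpos
    · exfalso; rw [h'] at h; linarith
  · exact Or.inr him

/-- The closed sector `{w | re w ≤ ‖w‖/2}` minus the origin lies in the opposite slit plane.
[folklore] [cite: Glaeser1963Newton, Thm. II (summary p. 4)] -/
theorem neg_mem_slitPlane_of_re_le_norm_div_two {w : ℂ} (hw : w ≠ 0) (h : w.re ≤ ‖w‖ / 2) :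
    -w ∈ slitPlane := by
  rw [mem_slitPlane_iff]
  by_cases him : w.im = 0
  · left
    have habs : |w.re| = ‖w‖ := Complex.abs_re_eq_norm.2 him
    have hpos : 0 < ‖w‖ := norm_pos_iff.2 hw
    rcases abs_eq_abs.1 (habs.trans (abs_of_pos hpos).symm) with h' | h'
    · exfalso; rw [h'] at h; linarith
    · simp only [Complex.neg_re]; rw [h']; linarith
  · right; simpa using him



section Descent

variable {P : Type u} [NormedAddCommGroup P] [NormedSpace ℝ P]
  {E : Type u} [NormedAddCommGroup E] [NormedSpace ℝ E]

/-! ### The descended function and its smoothness off the zero section -/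

/-- A rotation-invariant function on `ℂ × P` descends along `w ↦ w³`: there is `K` with
`f (c, z) = K (c³, z)` for ALL `c` (this identity determines `K`, every complex number being a
cube). [folklore] [cite: Glaeser1963Newton, Thm. II (summary p. 4)] -/
theorem exists_comp_cube_eq_of_rotInvariant {α β : Type*} (f : ℂ × β → α)
    (hrot : ∀ (w : ℂ) (z : β), f (Complex.exp (2 * π * I / 3) * w, z) = f (w, z)) :
    ∃ K : ℂ × β → α, ∀ (c : ℂ) (z : β), f (c, z) = K (c ^ 3, z) := by
  classical
  refine ⟨fun q => f (if q.1 = 0 then 0 else Complex.exp (Complex.log q.1 / 3), q.2),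
    fun c z => ?_⟩
  refine apply_eq_of_pow_three_eq_of_rotInvariant f hrot ?_ z
  dsimp only
  split_ifs with hc
  · rw [hc]; simp
  · rw [exp_log_div_three_pow_three hc]

/-- Off the zero section the descended function is locally the composition of `f` with a smooth
cube-root branch, hence `C^∞` there. [folklore] [cite: Glaeser1963Newton, Thm. II (summary p. 4)] -/
theorem contDiffOn_of_comp_cube_eq (f : ℂ × P → E) (hf : ContDiff ℝ ∞ f) (K : ℂ × P → E)
    (hK : ∀ (c : ℂ) (z : P), f (c, z) = K (c ^ 3, z)) :
    ContDiffOn ℝ ∞ K {q : ℂ × P | q.1 ≠ 0} := by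
  intro q hq
  refine ContDiffAt.contDiffWithinAt ?_
  rcases mem_slitPlane_or_neg_mem_slitPlane (w := q.1) hq with h | h
  · -- principal branch
    have hs : {p : ℂ × P | p.1 ∈ slitPlane} ∈ 𝓝 q :=
      (isOpen_slitPlane.preimage continuous_fst).mem_nhds h
    have heq : K =ᶠ[𝓝 q] fun p : ℂ × P => f (Complex.exp (Complex.log p.1 / 3), p.2) := by
      filter_upwards [hs] with p hp
      rw [hK, exp_log_div_three_pow_three (slitPlane_ne_zero hp)]
    refine ContDiffAt.congr_of_eventuallyEq ?_ heq
    exact hf.contDiffAt.comp q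
      (((contDiffAt_exp_log_div_three h).comp q contDiffAt_fst).prodMk contDiffAt_snd)
  · have hs : {p : ℂ × P | -p.1 ∈ slitPlane} ∈ 𝓝 q :=
      (isOpen_slitPlane.preimage (continuous_fst.neg)).mem_nhds h
    have heq : K =ᶠ[𝓝 q] fun p : ℂ × P => f (-Complex.exp (Complex.log (-p.1) / 3), p.2) := by
      filter_upwards [hs] with p hp
      rw [hK, neg_exp_log_neg_div_three_pow_three (neg_ne_zero.1 (slitPlane_ne_zero hp))]
    refine ContDiffAt.congr_of_eventuallyEq ?_ heq
    exact hf.contDiffAt.comp q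
      (((contDiffAt_neg_exp_log_neg_div_three h).comp q contDiffAt_fst).prodMk contDiffAt_snd)

/-! ### Quantitative inputs: flatness constants and branch bounds on the annulus -/

/-- Uniform flatness constants for all derivatives of order `≤ n` near a section point, from the
`=O(‖q.1‖ ^ N)` currency. [folklore] [cite: Glaeser1963Newton, Thm. II (summary p. 4)] -/
theorem exists_forall_norm_iteratedFDeriv_le_of_flat (f : ℂ × P → E) (hf : ContDiff ℝ ∞ f)
    (hflat : ∀ (n : ℕ) (z : P), iteratedFDeriv ℝ n f (0, z) = 0) (n N : ℕ) (z₀ : P) :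
    ∃ C δ : ℝ, 0 ≤ C ∧ 0 < δ ∧ ∀ i ≤ n, ∀ q : ℂ × P, dist q (0, z₀) < δ →
      ‖iteratedFDeriv ℝ i f q‖ ≤ C * ‖q.1‖ ^ N := by
  have h1 : ∀ i : ℕ, ∃ C δ : ℝ, 0 ≤ C ∧ 0 < δ ∧ ∀ q : ℂ × P, dist q (0, z₀) < δ →
      ‖iteratedFDeriv ℝ i f q‖ ≤ C * ‖q.1‖ ^ N := by
    intro i
    obtain ⟨C, hC0, hC⟩ :=
      (isBigO_iteratedFDeriv_norm_fst_pow_of_zeroSection hf hflat i N z₀).exists_nonneg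
    rw [Asymptotics.IsBigOWith_def, Metric.eventually_nhds_iff] at hC
    obtain ⟨δ, hδ, h⟩ := hC
    refine ⟨C, δ, hC0, hδ, fun q hq => ?_⟩
    have := h hq
    rwa [Real.norm_of_nonneg (by positivity)] at this
  choose C δ hC0 hδ hCδ using h1
  refine ⟨∑ i ∈ Finset.range (n + 1), C i, (Finset.range (n + 1)).inf' ⟨0, by simp⟩ δ,
    Finset.sum_nonneg fun i _ => hC0 i, (Finset.lt_inf'_iff _).2 fun i _ => hδ i,
    fun i hi q hq => ?_⟩
  have him : i ∈ Finset.range (n + 1) := Finset.mem_range.2 (Nat.lt_succ_of_le hi)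
  have hq' : dist q (0, z₀) < δ i := lt_of_lt_of_le hq (Finset.inf'_le _ him)
  refine (hCδ i q hq').trans ?_
  gcongr
  exact Finset.single_le_sum (fun j _ => hC0 j) him

/-- A smooth map has all `iteratedFDerivWithin` of orders `1 … n` bounded by ONE constant `D ≥ 1`
(hence by `D ^ i`) on a compact subset of an open set. [folklore] [cite: Glaeser1963Newton, Thm. II (summary p. 4)] -/
theorem exists_forall_norm_iteratedFDerivWithin_le_pow {X Y : Type*} [NormedAddCommGroup X]
    [NormedSpace ℝ X] [NormedAddCommGroup Y] [NormedSpace ℝ Y] {Ψ : X → Y} {s Q : Set X}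
    (hs : IsOpen s) (hΨ : ContDiffOn ℝ ∞ Ψ s) (hQ : IsCompact Q) (hQs : Q ⊆ s) (n : ℕ) :
    ∃ D : ℝ, 1 ≤ D ∧ ∀ q ∈ Q, ∀ i, 1 ≤ i → i ≤ n → ‖iteratedFDerivWithin ℝ i Ψ s q‖ ≤ D ^ i := by
  have h1 : ∀ i : ℕ, ∃ B : ℝ, 0 ≤ B ∧ ∀ q ∈ Q, ‖iteratedFDerivWithin ℝ i Ψ s q‖ ≤ B := by
    intro i
    have hcont : ContinuousOn (iteratedFDerivWithin ℝ i Ψ s) Q :=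
      (hΨ.continuousOn_iteratedFDerivWithin (m := i) (by exact_mod_cast le_top)
        hs.uniqueDiffOn).mono hQs
    obtain ⟨B, hB⟩ := hQ.exists_bound_of_continuousOn hcont
    exact ⟨max B 0, le_max_right _ _, fun q hq => (hB q hq).trans (le_max_left _ _)⟩
  choose B hB0 hB using h1
  refine ⟨1 + ∑ i ∈ Finset.range (n + 1), B i, le_add_of_nonneg_right
    (Finset.sum_nonneg fun i _ => hB0 i), fun q hq i hi1 hin => ?_⟩
  have him : i ∈ Finset.range (n + 1) := Finset.mem_range.2 (Nat.lt_succ_of_le hin)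
  have hD1 : (1 : ℝ) ≤ 1 + ∑ i ∈ Finset.range (n + 1), B i :=
    le_add_of_nonneg_right (Finset.sum_nonneg fun i _ => hB0 i)
  calc ‖iteratedFDerivWithin ℝ i Ψ s q‖ ≤ B i := hB i q hq
    _ ≤ ∑ j ∈ Finset.range (n + 1), B j := Finset.single_le_sum (fun j _ => hB0 j) him
    _ ≤ 1 + ∑ j ∈ Finset.range (n + 1), B j := le_add_of_nonneg_left zero_le_one
    _ ≤ (1 + ∑ j ∈ Finset.range (n + 1), B j) ^ i := le_self_pow₀ hD1 (by omega)

end Descent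


section Key

variable {P : Type u} [NormedAddCommGroup P] [NormedSpace ℝ P] [FiniteDimensional ℝ P]
  {E : Type u} [NormedAddCommGroup E] [NormedSpace ℝ E]

/-- Norm of a cube root: `‖c‖ ≤ 2` when `‖c ^ 3‖ ≤ 8`. [folklore] [cite: Glaeser1963Newton, Thm. II (summary p. 4)] -/
theorem norm_le_two_of_norm_pow_three_le {c : ℂ} (h : ‖c ^ 3‖ ≤ 8) : ‖c‖ ≤ 2 := by
  rw [norm_pow] at h
  by_contra h'
  push Not at h'
  have : (2 : ℝ) ^ 3 < ‖c‖ ^ 3 := by gcongr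
  linarith

/-- **Key decay estimate for the flat `C₃`-descent.** If `f` is smooth with all derivatives
vanishing on `{0} × P` and `f (c, z) = K (c ^ 3, z)`, then every (global) iterated derivative of
`K` tends to `0` at every section point from the off-section side: on the dyadic shell
`8^{-m} ≤ ‖w‖ ≤ 8^{1-m}` one has `‖Dⁿ K‖ ≤ A · 2^{-m}`, by dilating to the fixed annulus
`1 ≤ ‖w‖ ≤ 8`, where `K` is `f ∘ (2^{-m} • cube-root branch)` and the chain rule bound
(Mathlib's `norm_iteratedFDerivWithin_comp_le`) meets the flatness bound
`‖Dⁱ f (w, z)‖ ≤ C ‖w‖ ^ (3n+1)`. [folklore] [cite: Glaeser1963Newton, Thm. II (summary p. 4)] -/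
theorem tendsto_iteratedFDeriv_of_comp_cube_eq (f : ℂ × P → E) (hf : ContDiff ℝ ∞ f)
    (hflat : ∀ (n : ℕ) (z : P), iteratedFDeriv ℝ n f (0, z) = 0) (K : ℂ × P → E)
    (hK : ∀ (c : ℂ) (z : P), f (c, z) = K (c ^ 3, z)) (n : ℕ) (z₀ : P) :
    Tendsto (fun q => iteratedFDeriv ℝ n K q) (𝓝[{q : ℂ × P | q.1 ≠ 0}] (0, z₀)) (𝓝 0) := by
  -- (1) flatness constants for the orders `≤ n` with `N = 3 n + 1`
  obtain ⟨C, δ, hC0, hδ, hCδ⟩ :=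
    exists_forall_norm_iteratedFDeriv_le_of_flat f hf hflat n (3 * n + 1) z₀
  -- (2) the two cube-root branches as maps of `ℂ × P`, their open domains and compact annular
  -- sectors
  set Ψ₀ : ℂ × P → ℂ × P := fun q => (Complex.exp (Complex.log q.1 / 3), q.2) with hΨ₀
  set Ψ₁ : ℂ × P → ℂ × P := fun q => (-Complex.exp (Complex.log (-q.1) / 3), q.2) with hΨ₁
  set s₀ : Set (ℂ × P) := {q | q.1 ∈ slitPlane} with hs₀
  set s₁ : Set (ℂ × P) := {q | -q.1 ∈ slitPlane} with hs₁
  have hs₀o : IsOpen s₀ := isOpen_slitPlane.preimage continuous_fst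
  have hs₁o : IsOpen s₁ := isOpen_slitPlane.preimage continuous_fst.neg
  have hΨ₀s : ContDiffOn ℝ ∞ Ψ₀ s₀ := fun q hq =>
    (((contDiffAt_exp_log_div_three hq).comp q contDiffAt_fst).prodMk
      contDiffAt_snd).contDiffWithinAt
  have hΨ₁s : ContDiffOn ℝ ∞ Ψ₁ s₁ := fun q hq =>
    (((contDiffAt_neg_exp_log_neg_div_three hq).comp q contDiffAt_fst).prodMk
      contDiffAt_snd).contDiffWithinAt
  set Q₀ : Set (ℂ × P) := (({q : ℂ × P | 1 ≤ ‖q.1‖} ∩ {q | ‖q.1‖ ≤ 8}) ∩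
    {q | -‖q.1‖ / 2 ≤ q.1.re}) ∩ {q | dist q.2 z₀ ≤ 1} with hQ₀
  set Q₁ : Set (ℂ × P) := (({q : ℂ × P | 1 ≤ ‖q.1‖} ∩ {q | ‖q.1‖ ≤ 8}) ∩
    {q | q.1.re ≤ ‖q.1‖ / 2}) ∩ {q | dist q.2 z₀ ≤ 1} with hQ₁
  have hQ₀s : Q₀ ⊆ s₀ := fun q ⟨⟨⟨h1, _⟩, h3⟩, _⟩ =>
    mem_slitPlane_of_neg_norm_div_two_le_re (norm_pos_iff.1 (by
      change 1 ≤ ‖q.1‖ at h1; linarith)) h3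
  have hQ₁s : Q₁ ⊆ s₁ := fun q ⟨⟨⟨h1, _⟩, h3⟩, _⟩ =>
    neg_mem_slitPlane_of_re_le_norm_div_two (norm_pos_iff.1 (by
      change 1 ≤ ‖q.1‖ at h1; linarith)) h3
  have hbdd : ∀ Q : Set (ℂ × P), (∀ q ∈ Q, ‖q.1‖ ≤ 8 ∧ dist q.2 z₀ ≤ 1) →
      Bornology.IsBounded Q := by
    intro Q hQ
    refine (Metric.isBounded_iff_subset_closedBall (0, z₀)).2 ⟨8 + 1, fun q hq => ?_⟩
    obtain ⟨h1, h2⟩ := hQ q hq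
    rw [mem_closedBall, Prod.dist_eq]
    refine max_le ?_ (h2.trans (by norm_num))
    rw [dist_zero_right]; linarith
  have hc1 : IsClosed {q : ℂ × P | 1 ≤ ‖q.1‖} := isClosed_le continuous_const continuous_fst.norm
  have hc2 : IsClosed {q : ℂ × P | ‖q.1‖ ≤ 8} := isClosed_le continuous_fst.norm continuous_const
  have hc3 : IsClosed {q : ℂ × P | -‖q.1‖ / 2 ≤ q.1.re} :=
    isClosed_le ((continuous_fst.norm.neg).div_const _) (Complex.continuous_re.comp continuous_fst)
  have hc3' : IsClosed {q : ℂ × P | q.1.re ≤ ‖q.1‖ / 2} :=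
    isClosed_le (Complex.continuous_re.comp continuous_fst) (continuous_fst.norm.div_const _)
  have hc4 : IsClosed {q : ℂ × P | dist q.2 z₀ ≤ 1} :=
    isClosed_le (continuous_snd.dist continuous_const) continuous_const
  have hQ₀c : IsCompact Q₀ :=
    Metric.isCompact_of_isClosed_isBounded (((hc1.inter hc2).inter hc3).inter hc4)
      (hbdd Q₀ fun q ⟨⟨⟨_, h2⟩, _⟩, h4⟩ => ⟨h2, h4⟩)
  have hQ₁c : IsCompact Q₁ :=
    Metric.isCompact_of_isClosed_isBounded (((hc1.inter hc2).inter hc3').inter hc4)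
      (hbdd Q₁ fun q ⟨⟨⟨_, h2⟩, _⟩, h4⟩ => ⟨h2, h4⟩)
  obtain ⟨D₀, hD₀1, hD₀⟩ := exists_forall_norm_iteratedFDerivWithin_le_pow hs₀o hΨ₀s hQ₀c hQ₀s n
  obtain ⟨D₁, hD₁1, hD₁⟩ := exists_forall_norm_iteratedFDerivWithin_le_pow hs₁o hΨ₁s hQ₁c hQ₁s n
  set D : ℝ := max D₀ D₁ with hD
  have hD1 : 1 ≤ D := hD₀1.trans (le_max_left _ _)
  -- (3) the final constant and the choice of the depth `m₀`
  set A : ℝ := n.factorial * (C * 2 ^ (3 * n + 1)) * D ^ n with hA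
  have hA0 : 0 ≤ A := by positivity
  rw [Metric.tendsto_nhdsWithin_nhds]
  intro ε hε
  obtain ⟨m₀, hm₀⟩ := exists_pow_lt_of_lt_one
    (lt_min (div_pos hε (by positivity : (0 : ℝ) < A + 1)) (half_pos hδ))
    (by norm_num : (1 / 2 : ℝ) < 1)
  have hm₀ε : (1 / 2 : ℝ) ^ m₀ < ε / (A + 1) := lt_of_lt_of_le hm₀ (min_le_left _ _)
  have hm₀δ : (1 / 2 : ℝ) ^ m₀ < δ / 2 := lt_of_lt_of_le hm₀ (min_le_right _ _)
  refine ⟨min (min δ 1) ((1 / 8 : ℝ) ^ m₀), lt_min (lt_min hδ one_pos) (by positivity), ?_⟩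
  rintro ⟨w₀, z⟩ hw₀ hdist
  change w₀ ≠ 0 at hw₀
  rw [Prod.dist_eq, max_lt_iff, dist_zero_right] at hdist
  obtain ⟨hw₀n, hzd⟩ := hdist
  have hw₀1 : ‖w₀‖ < (1 / 8 : ℝ) ^ m₀ := lt_of_lt_of_le hw₀n (min_le_right _ _)
  have hzδ : dist z z₀ < δ := lt_of_lt_of_le hzd ((min_le_left _ _).trans (min_le_left _ _))
  have hz1 : dist z z₀ < 1 := lt_of_lt_of_le hzd ((min_le_left _ _).trans (min_le_right _ _))
  rw [dist_zero_right]
  -- (4) the dyadic depth `m` of `w₀`: `1 < 8^m ‖w₀‖ ≤ 8`, and `m₀ < m`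
  have hw₀pos : 0 < ‖w₀‖ := norm_pos_iff.2 hw₀
  have hw₀le1 : ‖w₀‖ ≤ 1 := by
    refine hw₀1.le.trans (pow_le_one₀ (by norm_num) (by norm_num))
  obtain ⟨k, hk1, hk2⟩ := exists_nat_pow_near (one_le_inv_iff₀.2 ⟨hw₀pos, hw₀le1⟩)
    (by norm_num : (1 : ℝ) < 8)
  set m : ℕ := k + 1 with hm
  have hinv : ‖w₀‖⁻¹ * ‖w₀‖ = 1 := inv_mul_cancel₀ hw₀pos.ne'
  have hm1 : 1 < (8 : ℝ) ^ m * ‖w₀‖ := by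
    have := mul_lt_mul_of_pos_right hk2 hw₀pos
    rwa [hinv] at this
  have hm8 : (8 : ℝ) ^ m * ‖w₀‖ ≤ 8 := by
    have h' : (8 : ℝ) ^ k * ‖w₀‖ ≤ 1 := by
      have := mul_le_mul_of_nonneg_right hk1 hw₀pos.le
      rwa [hinv] at this
    rw [hm, pow_succ]; nlinarith
  have hm₀m : m₀ < m := by
    have h1 : (8 : ℝ) ^ m₀ < ‖w₀‖⁻¹ := by
      rw [one_div, inv_pow] at hw₀1
      exact (lt_inv_comm₀ hw₀pos (by positivity)).1 hw₀1
    have h2 : (8 : ℝ) ^ m₀ < 8 ^ m := h1.trans hk2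
    exact (pow_lt_pow_iff_right₀ (by norm_num : (1 : ℝ) < 8)).1 h2
  have hhalf : (1 / 2 : ℝ) ^ m < (1 / 2 : ℝ) ^ m₀ :=
    pow_lt_pow_right_of_lt_one₀ (by norm_num) (by norm_num) hm₀m
  -- (5) the dilation `M (w, z) = (8^m • w, z)` and `K = K_m ∘ M`
  set c : ℝ := (8 : ℝ) ^ m with hc
  have hc1 : 1 ≤ c := one_le_pow₀ (by norm_num)
  have hc0 : c ≠ 0 := by positivity
  set M : (ℂ × P) ≃L[ℝ] (ℂ × P) := ContinuousLinearEquiv.equivOfInverse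
    (ContinuousLinearMap.prodMap (c • ContinuousLinearMap.id ℝ ℂ) (ContinuousLinearMap.id ℝ P))
    (ContinuousLinearMap.prodMap (c⁻¹ • ContinuousLinearMap.id ℝ ℂ) (ContinuousLinearMap.id ℝ P))
    (fun q => by ext <;> simp [Prod.map, hc0]) (fun q => by
      ext <;> simp [Prod.map, hc0]) with hM
  have hMapply : ∀ q : ℂ × P, M q = (c • q.1, q.2) := fun q => rfl
  have hMnorm : ‖(M : (ℂ × P) →L[ℝ] (ℂ × P))‖ ≤ c := by
    refine ContinuousLinearMap.opNorm_le_bound _ (by positivity) fun q => ?_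
    rw [ContinuousLinearEquiv.coe_coe, hMapply, Prod.norm_def, Prod.norm_def, norm_smul,
      Real.norm_of_nonneg (by positivity : (0 : ℝ) ≤ c)]
    refine max_le ?_ ?_
    · exact mul_le_mul_of_nonneg_left (le_max_left _ _) (by positivity)
    · calc ‖q.2‖ = 1 * ‖q.2‖ := (one_mul _).symm
        _ ≤ c * max ‖q.1‖ ‖q.2‖ := mul_le_mul hc1 (le_max_right _ _) (norm_nonneg _) (by positivity)
  set Km : ℂ × P → E := fun q => K (c⁻¹ • q.1, q.2) with hKm
  have hKM : K = Km ∘ M := by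
    funext q
    simp only [hKm, Function.comp_apply, hMapply, smul_smul, inv_mul_cancel₀ hc0, one_smul]
  set y : ℂ × P := M (w₀, z) with hy
  have hy1 : y.1 = c • w₀ := rfl
  have hy2 : y.2 = z := rfl
  have hy1n : ‖y.1‖ = c * ‖w₀‖ := by
    rw [hy1, norm_smul, Real.norm_of_nonneg (by positivity)]
  have hy1ne : y.1 ≠ 0 := by
    rw [← norm_pos_iff, hy1n]; linarith
  -- `‖Dⁿ K (w₀, z)‖ ≤ ‖Dⁿ K_m y‖ · c ^ n`
  have hstep1 : ‖iteratedFDeriv ℝ n K (w₀, z)‖ ≤ ‖iteratedFDeriv ℝ n Km y‖ * c ^ n := by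
    have h := M.iteratedFDerivWithin_comp_right Km uniqueDiffOn_univ (mem_univ (M (w₀, z))) n
    rw [Set.preimage_univ, iteratedFDerivWithin_univ, iteratedFDerivWithin_univ, ← hKM] at h
    rw [h]
    refine (ContinuousMultilinearMap.norm_compContinuousLinearMap_le _ _).trans ?_
    rw [Finset.prod_const, Finset.card_univ, Fintype.card_fin]
    exact mul_le_mul_of_nonneg_left (pow_le_pow_left₀ (norm_nonneg _) hMnorm n) (norm_nonneg _)
  -- (6) the contraction `L (w, z) = (2^{-m} • w, z)` and the flatness of `f ∘ L` on cube roots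
  set L : (ℂ × P) →L[ℝ] (ℂ × P) := ContinuousLinearMap.prodMap
    (((2 : ℝ) ^ m)⁻¹ • ContinuousLinearMap.id ℝ ℂ) (ContinuousLinearMap.id ℝ P) with hL
  have hLapply : ∀ q : ℂ × P, L q = (((2 : ℝ) ^ m)⁻¹ • q.1, q.2) := fun q => rfl
  have h2m : ((2 : ℝ) ^ m)⁻¹ = (1 / 2 : ℝ) ^ m := by rw [one_div, inv_pow]
  have h2m1 : ((2 : ℝ) ^ m)⁻¹ ≤ 1 := by
    rw [h2m]; exact pow_le_one₀ (by norm_num) (by norm_num)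
  have hLnorm : ‖L‖ ≤ 1 := by
    refine ContinuousLinearMap.opNorm_le_bound _ zero_le_one fun q => ?_
    rw [hLapply, Prod.norm_def, Prod.norm_def, norm_smul, one_mul,
      Real.norm_of_nonneg (by positivity : (0 : ℝ) ≤ ((2 : ℝ) ^ m)⁻¹)]
    refine max_le ((mul_le_of_le_one_left (norm_nonneg _) h2m1).trans (le_max_left _ _))
      (le_max_right _ _)
  have hg : ContDiff ℝ ∞ (f ∘ L) := hf.comp L.contDiff
  set Cm : ℝ := C * (2 * (1 / 2 : ℝ) ^ m) ^ (3 * n + 1) with hCm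
  -- flatness of `f ∘ L` at any cube root `ξ` of `y.1` (paired with `z`)
  have hflatL : ∀ ξ : ℂ, ξ ^ 3 = y.1 → ∀ i ≤ n,
      ‖iteratedFDerivWithin ℝ i (f ∘ L) univ (ξ, z)‖ ≤ Cm := by
    intro ξ hξ i hi
    have hξ2 : ‖ξ‖ ≤ 2 := norm_le_two_of_norm_pow_three_le (by rw [hξ, hy1n]; exact hm8)
    rw [iteratedFDerivWithin_univ,
      L.iteratedFDeriv_comp_right hf _ (by exact_mod_cast le_top : (i : ℕ∞ω) ≤ ∞)]
    refine (ContinuousMultilinearMap.norm_compContinuousLinearMap_le _ _).trans ?_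
    rw [Finset.prod_const, Finset.card_univ, Fintype.card_fin]
    have hL1 : ‖L‖ ^ i ≤ 1 := pow_le_one₀ (norm_nonneg _) hLnorm
    have hpt : dist (L (ξ, z)) (0, z₀) < δ := by
      rw [hLapply, Prod.dist_eq, dist_zero_right, norm_smul,
        Real.norm_of_nonneg (by positivity : (0 : ℝ) ≤ ((2 : ℝ) ^ m)⁻¹), h2m]
      refine max_lt ?_ hzδ
      calc (1 / 2 : ℝ) ^ m * ‖ξ‖ ≤ (1 / 2 : ℝ) ^ m * 2 :=
            mul_le_mul_of_nonneg_left hξ2 (by positivity)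
        _ < (1 / 2 : ℝ) ^ m₀ * 2 := by gcongr
        _ < δ / 2 * 2 := by gcongr
        _ = δ := by ring
    have hfl := hCδ i hi (L (ξ, z)) hpt
    have hn1 : ‖(L (ξ, z)).1‖ ≤ 2 * (1 / 2 : ℝ) ^ m := by
      rw [hLapply, norm_smul, Real.norm_of_nonneg (by positivity : (0 : ℝ) ≤ ((2 : ℝ) ^ m)⁻¹),
        h2m, mul_comm]
      exact mul_le_mul_of_nonneg_right hξ2 (by positivity)
    calc ‖iteratedFDeriv ℝ i f (L (ξ, z))‖ * ‖L‖ ^ i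
        ≤ ‖iteratedFDeriv ℝ i f (L (ξ, z))‖ * 1 :=
          mul_le_mul_of_nonneg_left hL1 (norm_nonneg _)
      _ ≤ C * ‖(L (ξ, z)).1‖ ^ (3 * n + 1) := by rw [mul_one]; exact hfl
      _ ≤ Cm := by
          rw [hCm]
          exact mul_le_mul_of_nonneg_left (pow_le_pow_left₀ (norm_nonneg _) hn1 _) hC0
  -- (7) the chain-rule bound through ONE branch
  have hbranch : ∀ (ψ : ℂ → ℂ) (s : Set (ℂ × P)), IsOpen s →
      ContDiffOn ℝ ∞ (fun q : ℂ × P => (ψ q.1, q.2)) s → (∀ q ∈ s, ψ q.1 ^ 3 = q.1) → y ∈ s →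
      (∀ i, 1 ≤ i → i ≤ n →
        ‖iteratedFDerivWithin ℝ i (fun q : ℂ × P => (ψ q.1, q.2)) s y‖ ≤ D ^ i) →
      ‖iteratedFDeriv ℝ n Km y‖ ≤ n.factorial * Cm * D ^ n := by
    intro ψ s hso hΨ hψ3 hys hDy
    -- `K_m` agrees with `(f ∘ L) ∘ Ψ` near `y`
    have heq : Km =ᶠ[𝓝 y] ((f ∘ L) ∘ fun q : ℂ × P => (ψ q.1, q.2)) := by
      filter_upwards [hso.mem_nhds hys] with q hq
      simp only [hKm, Function.comp_apply, hLapply]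
      rw [hK, smul_pow, hψ3 q hq]
      congr 2
      rw [hc, ← inv_pow, ← inv_pow, ← pow_mul, mul_comm m 3, pow_mul]
      norm_num
    rw [(heq.iteratedFDeriv ℝ n).eq_of_nhds, ← iteratedFDerivWithin_of_isOpen n hso hys]
    exact norm_iteratedFDerivWithin_comp_le hg.contDiffOn hΨ (by exact_mod_cast le_top)
      uniqueDiffOn_univ hso.uniqueDiffOn (mapsTo_univ _ _) hys
      (fun i hi => hflatL (ψ y.1) (hψ3 y hys) i hi) hDy
  -- (8) pick the branch whose closed sector contains `y`
  have hDy : ‖iteratedFDeriv ℝ n Km y‖ ≤ n.factorial * Cm * D ^ n := by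
    have hyann : 1 ≤ ‖y.1‖ ∧ ‖y.1‖ ≤ 8 := ⟨by rw [hy1n]; exact hm1.le, by rw [hy1n]; exact hm8⟩
    have hyz : dist y.2 z₀ ≤ 1 := by rw [hy2]; exact hz1.le
    by_cases hre : -‖y.1‖ / 2 ≤ y.1.re
    · have hyQ : y ∈ Q₀ := ⟨⟨hyann, hre⟩, hyz⟩
      refine hbranch (fun w => Complex.exp (Complex.log w / 3)) s₀ hs₀o hΨ₀s
        (fun q hq => exp_log_div_three_pow_three (slitPlane_ne_zero hq)) (hQ₀s hyQ)
        fun i hi1 hin => (hD₀ y hyQ i hi1 hin).trans ?_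
      exact pow_le_pow_left₀ (zero_le_one.trans hD₀1) (le_max_left _ _) i
    · have hre' : y.1.re ≤ ‖y.1‖ / 2 := by
        push Not at hre; linarith [norm_nonneg y.1]
      have hyQ : y ∈ Q₁ := ⟨⟨hyann, hre'⟩, hyz⟩
      refine hbranch (fun w => -Complex.exp (Complex.log (-w) / 3)) s₁ hs₁o hΨ₁s
        (fun q hq => neg_exp_log_neg_div_three_pow_three
          (neg_ne_zero.1 (slitPlane_ne_zero hq))) (hQ₁s hyQ)
        fun i hi1 hin => (hD₁ y hyQ i hi1 hin).trans ?_
      exact pow_le_pow_left₀ (zero_le_one.trans hD₁1) (le_max_right _ _) i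
  -- (9) arithmetic: `c ^ n · n! · Cm · D ^ n = A · (1/2)^m < ε`
  have hexp : c ^ n * ((1 / 2 : ℝ) ^ m) ^ (3 * n + 1) = (1 / 2 : ℝ) ^ m := by
    have h1 : ((1 / 2 : ℝ) ^ m) ^ 3 = (1 / 8 : ℝ) ^ m := by
      rw [← pow_mul, mul_comm, pow_mul]; norm_num
    have h2 : c * (1 / 8 : ℝ) ^ m = 1 := by
      rw [hc, ← mul_pow]; norm_num
    calc c ^ n * ((1 / 2 : ℝ) ^ m) ^ (3 * n + 1)
        = c ^ n * ((((1 / 2 : ℝ) ^ m) ^ 3) ^ n * (1 / 2 : ℝ) ^ m) := by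
          rw [pow_succ, pow_mul]
      _ = (c * (1 / 8 : ℝ) ^ m) ^ n * (1 / 2 : ℝ) ^ m := by rw [h1, mul_pow]; ring
      _ = (1 / 2 : ℝ) ^ m := by rw [h2, one_pow, one_mul]
  have hfinal : ‖iteratedFDeriv ℝ n K (w₀, z)‖ ≤ A * (1 / 2 : ℝ) ^ m := by
    calc ‖iteratedFDeriv ℝ n K (w₀, z)‖ ≤ ‖iteratedFDeriv ℝ n Km y‖ * c ^ n := hstep1
      _ ≤ n.factorial * Cm * D ^ n * c ^ n :=
          mul_le_mul_of_nonneg_right hDy (by positivity)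
      _ = A * (c ^ n * ((1 / 2 : ℝ) ^ m) ^ (3 * n + 1)) := by
          rw [hA, hCm, mul_pow]; ring
      _ = A * (1 / 2 : ℝ) ^ m := by rw [hexp]
  calc ‖iteratedFDeriv ℝ n K (w₀, z)‖ ≤ A * (1 / 2 : ℝ) ^ m := hfinal
    _ ≤ A * (ε / (A + 1)) := mul_le_mul_of_nonneg_left (hhalf.le.trans hm₀ε.le) hA0
    _ < ε := by
        rw [mul_div_assoc']
        rw [div_lt_iff₀ (by positivity)]
        nlinarith

end Key


section Main

variable {P : Type u} [NormedAddCommGroup P] [NormedSpace ℝ P] [FiniteDimensional ℝ P]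
  {E : Type u} [NormedAddCommGroup E] [NormedSpace ℝ E] [CompleteSpace E]

omit [CompleteSpace E] in
/-- **Flat `C₃`-descent (Glaeser–`S₃` road G″, brick D).** A smooth `f : ℂ × P → E`, invariant
under the rotation `w ↦ exp(2πi/3) • w` and with ALL derivatives vanishing on the zero section
`{0} × P`, is a smooth function of `(w³, z)`: `f (w, z) = K (w³, z)` with `K` smooth on all of
`ℂ × P` and again flat along `{0} × P`. Road: descend set-theoretically (every cube-root fibre is
a rotation orbit), smooth off `0` through the two explicit branches `exp (log w / 3)`,
`-exp (log (-w) / 3)`, and at the section every derivative of `K` decays like `‖w‖^{1/3}` by the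
dyadic dilation estimate `tendsto_iteratedFDeriv_of_comp_cube_eq`; the flat-extension lemma
(★ B7 (i), LH10-p02) turns decay into smoothness. [folklore] [cite: Glaeser1963Newton, Thm. II (summary p. 4)] -/
theorem exists_contDiff_comp_cube_of_flat_of_rotInvariant (f : ℂ × P → E) (hf : ContDiff ℝ ∞ f)
    (hrot : ∀ (w : ℂ) (z : P), f (Complex.exp (2 * π * I / 3) * w, z) = f (w, z))
    (hflat : ∀ (n : ℕ) (z : P), iteratedFDeriv ℝ n f (0, z) = 0) :
    ∃ K : ℂ × P → E, ContDiff ℝ ∞ K ∧ (∀ (w : ℂ) (z : P), f (w, z) = K (w ^ 3, z)) ∧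
      ∀ (n : ℕ) (z : P), iteratedFDeriv ℝ n K (0, z) = 0 := by
  obtain ⟨K, hK⟩ := exists_comp_cube_eq_of_rotInvariant f hrot
  have h0 : ∀ z : P, K (0, z) = 0 := by
    intro z
    have h1 : f (0, z) = K (0, z) := by simpa using hK 0 z
    rw [← h1, ← norm_eq_zero, ← norm_iteratedFDeriv_zero (𝕜 := ℝ), hflat 0 z, norm_zero]
  obtain ⟨hKs, hKflat⟩ := contDiff_of_iteratedFDeriv_tendsto_zero_zeroSection
    (contDiffOn_of_comp_cube_eq f hf K hK) h0 (tendsto_iteratedFDeriv_of_comp_cube_eq f hf hflat K hK)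
  exact ⟨K, hKs, hK, hKflat⟩

/-- Real and imaginary parts of a cube. [folklore] [cite: Glaeser1963Newton, Thm. II (summary p. 4)] -/
theorem re_pow_three (w : ℂ) : (w ^ 3).re = w.re ^ 3 - 3 * w.re * w.im ^ 2 := by
  simp [pow_succ, Complex.mul_re, Complex.mul_im]; ring

/-- Real and imaginary parts of a cube. [folklore] [cite: Glaeser1963Newton, Thm. II (summary p. 4)] -/
theorem im_pow_three (w : ℂ) : (w ^ 3).im = 3 * w.re ^ 2 * w.im - w.im ^ 3 := by
  simp [pow_succ, Complex.mul_re, Complex.mul_im]; ring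

/-- `(Im w³)² = |w|⁶ − (Re w³)²` — the polynomial dictionary of road G″. [folklore] [cite: Glaeser1963Newton, Thm. II (summary p. 4)] -/
theorem im_pow_three_sq (w : ℂ) :
    (w ^ 3).im ^ 2 = Complex.normSq w ^ 3 - (w ^ 3).re ^ 2 := by
  have h := Complex.normSq_apply (w ^ 3)
  rw [map_pow] at h
  nlinarith [h]

/-- **Flat Glaeser–Chevalley at the `A₂` corner, complex form (road G″: cube first, then
Whitney).** A smooth `f : ℂ × P → E` invariant under the dihedral group `D₃ = ⟨w ↦ exp(2πi/3) w,
w ↦ w̄⟩` (the action of `S₃` on the Lagrange-resolvent line) whose derivatives all vanish on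
`{0} × P` is a smooth function of the two basic invariants `u = |w|²`, `v = Re w³` (and the
parameter): `f (w, z) = F (|w|², Re w³, z)` with `F` smooth on ALL of `ℝ × ℝ × P`.  Proof: flat
`C₃`-descent `f = K ∘ (w³, z)`; `K` is even under conjugation of `w′ = w³`, so ★ Whitney-several
(one variable `Im w′`, parameter `(Re w′, z)`) gives `K (w′, z) = U ((Im w′)², (Re w′, z))`, and
`(Im w³)² = u³ − v²`, `Re w³ = v`. No polar coordinates, no one-sided estimates. [folklore]
[cite: Glaeser1963Newton, Thm. II (summary p. 4)] [cite: Whitney1943, Thm. 1] [cite: Seeley1964, Theorem] -/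
theorem exists_contDiff_comp_dihedralInvariants_of_flat (f : ℂ × P → E) (hf : ContDiff ℝ ∞ f)
    (hrot : ∀ (w : ℂ) (z : P), f (Complex.exp (2 * π * I / 3) * w, z) = f (w, z))
    (hconj : ∀ (w : ℂ) (z : P), f (starRingEnd ℂ w, z) = f (w, z))
    (hflat : ∀ (n : ℕ) (z : P), iteratedFDeriv ℝ n f (0, z) = 0) :
    ∃ F : ℝ × ℝ × P → E, ContDiff ℝ ∞ F ∧
      ∀ (w : ℂ) (z : P), f (w, z) = F (Complex.normSq w, (w ^ 3).re, z) := by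
  classical
  obtain ⟨K, hKs, hK, -⟩ := exists_contDiff_comp_cube_of_flat_of_rotInvariant f hf hrot hflat
  -- `K` is even under conjugation
  have hKconj : ∀ (w' : ℂ) (z : P), K (starRingEnd ℂ w', z) = K (w', z) := by
    intro w' z
    set ξ : ℂ := if w' = 0 then 0 else Complex.exp (Complex.log w' / 3) with hξ
    have hξ3 : ξ ^ 3 = w' := by
      rw [hξ]; split_ifs with h
      · rw [h]; simp
      · exact exp_log_div_three_pow_three h
    have h1 : (starRingEnd ℂ ξ) ^ 3 = starRingEnd ℂ w' := by rw [← map_pow, hξ3]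
    rw [← h1, ← hK, hconj, hK, hξ3]
  -- Whitney in the variable `Im w′` with parameter `(Re w′, z)`
  set F₁ : (Fin 1 → ℝ) × (ℝ × P) → E :=
    fun p => K (Complex.equivRealProdCLM.symm (p.2.1, p.1 0), p.2.2) with hF₁
  have hF₁s : ContDiff ℝ ∞ F₁ := by
    refine hKs.comp (ContDiff.prodMk ?_ (contDiff_snd.comp contDiff_snd))
    exact Complex.equivRealProdCLM.symm.contDiff.comp
      ((contDiff_fst.comp contDiff_snd).prodMk ((contDiff_apply ℝ ℝ 0).comp contDiff_fst))
  have hF₁even : ∀ (i : Fin 1) (ρ : Fin 1 → ℝ) (zz : ℝ × P),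
      F₁ (update ρ i (-ρ i), zz) = F₁ (ρ, zz) := by
    intro i ρ zz
    obtain rfl : i = 0 := Subsingleton.elim _ _
    simp only [hF₁, update_self]
    have hc : Complex.equivRealProdCLM.symm (zz.1, -ρ 0) =
        starRingEnd ℂ (Complex.equivRealProdCLM.symm (zz.1, ρ 0)) := by
      apply Complex.ext <;> simp [Complex.equivRealProdCLM_symm_apply]
    rw [hc, hKconj]
  obtain ⟨U, hU, hUF, -⟩ := exists_contDiff_comp_sq_of_forall_even F₁ hF₁s hF₁even
  refine ⟨fun p => U (fun _ => p.1 ^ 3 - p.2.1 ^ 2, (p.2.1, p.2.2)), ?_, fun w z => ?_⟩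
  · refine hU.comp (ContDiff.prodMk (contDiff_pi.2 fun _ => ?_)
      ((contDiff_fst.comp contDiff_snd).prodMk (contDiff_snd.comp contDiff_snd)))
    exact (contDiff_fst.pow 3).sub ((contDiff_fst.comp contDiff_snd).pow 2)
  · have hw3 : (w ^ 3 : ℂ) = Complex.equivRealProdCLM.symm ((w ^ 3).re, (w ^ 3).im) := by
      apply Complex.ext <;> simp [Complex.equivRealProdCLM_symm_apply]
    have h1 : f (w, z) = F₁ (fun _ => (w ^ 3).im, ((w ^ 3).re, z)) := by
      rw [hK, hF₁]; dsimp only; rw [← hw3]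
    rw [h1, hUF]
    dsimp only
    rw [im_pow_three_sq]

/-- `exp (2πi/3) = −1/2 + (√3/2) i`. [folklore] [cite: Glaeser1963Newton, Thm. II (summary p. 4)] -/
theorem exp_two_pi_mul_I_div_three :
    Complex.exp (2 * π * I / 3) = ⟨-1 / 2, Real.sqrt 3 / 2⟩ := by
  have h : (2 * π * I / 3 : ℂ) = ((2 * π / 3 : ℝ) : ℂ) * I := by push_cast; ring
  rw [h, Complex.exp_mul_I, ← Complex.ofReal_cos, ← Complex.ofReal_sin]
  have hc : Real.cos (2 * π / 3) = -1 / 2 := by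
    rw [show 2 * π / 3 = π - π / 3 by ring, Real.cos_pi_sub, Real.cos_pi_div_three]; ring
  have hs : Real.sin (2 * π / 3) = Real.sqrt 3 / 2 := by
    rw [show 2 * π / 3 = π - π / 3 by ring, Real.sin_pi_sub, Real.sin_pi_div_three]
  rw [hc, hs]
  apply Complex.ext <;> simp

/-- **Flat Glaeser–Chevalley at the `A₂` corner, real form** (the binder's `ℝ × ℝ × P`
coordinates `(a, b, z)`, `w = a + ib`): a smooth `Φ` invariant under the rotation by `2π/3` and
even in `b`, with all derivatives vanishing on `{(0, 0)} × P`, is `G (a² + b², a³ − 3ab², z)` with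
`G` smooth on all of `ℝ × ℝ × P`. [folklore] [cite: Glaeser1963Newton, Thm. II (summary p. 4)] [cite: Whitney1943, Thm. 1] [cite: Seeley1964, Theorem] -/
theorem exists_contDiff_comp_dihedralInvariants_of_flat_real (Φ : ℝ × ℝ × P → E)
    (hΦ : ContDiff ℝ ∞ Φ)
    (hrot : ∀ (a b : ℝ) (z : P),
      Φ (-a / 2 - Real.sqrt 3 / 2 * b, Real.sqrt 3 / 2 * a - b / 2, z) = Φ (a, b, z))
    (heven : ∀ (a b : ℝ) (z : P), Φ (a, -b, z) = Φ (a, b, z))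
    (hflat : ∀ (n : ℕ) (z : P), iteratedFDeriv ℝ n Φ (0, 0, z) = 0) :
    ∃ G : ℝ × ℝ × P → E, ContDiff ℝ ∞ G ∧
      ∀ (a b : ℝ) (z : P), Φ (a, b, z) = G (a ^ 2 + b ^ 2, a ^ 3 - 3 * a * b ^ 2, z) := by
  -- transport to `ℂ × P` along the real-linear isomorphism `(w, z) ↦ (Re w, Im w, z)`
  set T : (ℂ × P) →L[ℝ] (ℝ × ℝ × P) :=
    (Complex.reCLM.comp (ContinuousLinearMap.fst ℝ ℂ P)).prod
      ((Complex.imCLM.comp (ContinuousLinearMap.fst ℝ ℂ P)).prod (ContinuousLinearMap.snd ℝ ℂ P))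
    with hT
  have hTapply : ∀ (w : ℂ) (z : P), T (w, z) = (w.re, w.im, z) := fun w z => rfl
  set f : ℂ × P → E := Φ ∘ T with hf
  have hfapply : ∀ (w : ℂ) (z : P), f (w, z) = Φ (w.re, w.im, z) := fun w z => rfl
  have hfs : ContDiff ℝ ∞ f := hΦ.comp T.contDiff
  have hfrot : ∀ (w : ℂ) (z : P), f (Complex.exp (2 * π * I / 3) * w, z) = f (w, z) := by
    intro w z
    rw [hfapply, hfapply, exp_two_pi_mul_I_div_three, Complex.mul_re, Complex.mul_im]
    dsimp only
    have h1 : -1 / 2 * w.re - Real.sqrt 3 / 2 * w.im = -w.re / 2 - Real.sqrt 3 / 2 * w.im := by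
      ring
    have h2 : -1 / 2 * w.im + Real.sqrt 3 / 2 * w.re = Real.sqrt 3 / 2 * w.re - w.im / 2 := by
      ring
    rw [h1, h2, hrot]
  have hfconj : ∀ (w : ℂ) (z : P), f (starRingEnd ℂ w, z) = f (w, z) := by
    intro w z
    rw [hfapply, hfapply, Complex.conj_re, Complex.conj_im, heven]
  have hfflat : ∀ (n : ℕ) (z : P), iteratedFDeriv ℝ n f (0, z) = 0 := by
    intro n z
    rw [hf, T.iteratedFDeriv_comp_right hΦ _ (by exact_mod_cast le_top), hTapply,
      Complex.zero_re, Complex.zero_im, hflat]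
    rfl
  obtain ⟨F, hF, hfF⟩ := exists_contDiff_comp_dihedralInvariants_of_flat f hfs hfrot hfconj hfflat
  refine ⟨F, hF, fun a b z => ?_⟩
  have h := hfF ⟨a, b⟩ z
  rw [hfapply] at h
  have h1 : Complex.normSq (⟨a, b⟩ : ℂ) = a ^ 2 + b ^ 2 := by rw [Complex.normSq_mk]; ring
  have h2 : ((⟨a, b⟩ : ℂ) ^ 3).re = a ^ 3 - 3 * a * b ^ 2 := by rw [re_pow_three]
  rw [h1, h2] at h
  exact h

end Main

end Literature.Analysis.Calculus
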